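import Literature.Analysis.FluidPDE.TorusHeatFlow
import HarnessLib

/-!
# Heat-kernel proof of the interior Hölder estimate for second derivatives on the torus

Analysis/FluidPDE support file (all results proved; no definitions, no named facts). It serves
the discharge of the named fact `Literature.Analysis.FluidPDE.BDSV.holderCZBound`
(`FluidPDE/OnsagerBDSVPotentialTheory`; Buckmaster–De Lellis–Székelyhidi–Vicol 2019, App. C,
Prop. C.1: periodic Calderón–Zygmund operators — there `∂ᵢ∂ⱼΔ⁻¹` — are bounded on `C^α(T³)`,
`0 < α < 1`), carried out in `FluidPDE/OnsagerBDSVPotentialTheoryProofs`, and continues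
`FluidPDE/TorusHeatFlow` (heat flow `e^{σΔ} = heatExtension · σ` of periodic lifts `g̃ = Torus.lift g`
of smooth torus functions to `ℝ^d`).

The classical Hölder estimate is obtained through the heat semigroup (the device of
`TorusHeatFlow` for the BDSV pressure, one derivative lower): if `g, u, f` are smooth on `T^d`
with `g = ∂_{v₁}∂_{v₂} u` and `Δg = ∂_{v₁}∂_{v₂} f` (for `∂ᵢ∂ⱼΔ⁻¹`: `u = Δ⁻¹f`, `g = ∂ᵢ∂ⱼu`), then

  `g̃ = e^{1·Δ} g̃ - ∫₀¹ e^{σΔ} (∂_{v₁}∂_{v₂} f)~ dσ`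

(time fundamental theorem for the heat flow, `Δ e^{σΔ} g̃ = e^{σΔ} (Δg)~`, and `e^{aΔ}g̃ → g̃` as
`a → 0⁺`), where the far field `e^{Δ}(∂_{v₁}∂_{v₂}u)~` and its gradient are bounded by `sup |u|`
(second/third-order smoothing bounds for bounded data) and the near field is bounded by
`∫₀¹ σ^{β/2-1} dσ · [f]_β` and is `β`-Hölder with constant `≲ [f]_β` (split the time integral at
`σ = |x - y|²`, using `|e^{σΔ}(∂²f)~| ≲ σ^{β/2-1}[f]_β` and `|∇e^{σΔ}(∂²f)~| ≲ σ^{(β-3)/2}[f]_β`).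

## Main results

* second-order smoothing bounds `norm_heatExtension_lift_lineDeriv₂_le_of_bound`,
  `norm_heatExtension_lift_lineDeriv₂_le_of_holder` (from the first-order ones, `e^{2aΔ} = e^{aΔ}e^{aΔ}`);
* `norm_integral_Ioc_le_of_norm_le_rpow`, `norm_integral_Ioc_sub_le_of_bounds`: the abstract
  near-field calculus (an `F`-valued family `Φ σ x` with `|Φ σ x| ≤ K σ^{β/2-1}` and
  `|Φ σ x - Φ σ y| ≤ L σ^{(β-3)/2} |x - y|` on `σ ∈ (0,1]` has `|∫₀¹ Φ| ≤ 2K/β` and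
  `|∫₀¹ Φ(·,x) - ∫₀¹ Φ(·,y)| ≤ (4K/β + 2L/(1-β)) |x - y|^β`);
* `lift_eq_heatExtension_one_sub_integral`: the representation `g̃ = e^{Δ}g̃ - ∫₀¹ e^{σΔ}(Δg)~ dσ`;
* `exists_holder_bound_lineDeriv₂`: **the Hölder estimate** — a constant `K = K(d, β)` with
  `|g̃| ≤ K (sup|u| + [f]_β) ‖v₁‖ ‖v₂‖` and `|g̃ x - g̃ y| ≤ K (sup|u| + [f]_β) ‖v₁‖ ‖v₂‖ |x - y|^β`
  whenever `g = ∂_{v₁}∂_{v₂}u`, `Δg = ∂_{v₁}∂_{v₂}f` on `T^d`, `0 < β < 1`.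

## References

* T. Buckmaster, C. De Lellis, L. Székelyhidi Jr., V. Vicol, *Onsager's conjecture for admissible
  weak solutions*, CPAM 72 (2019) = arXiv:1701.08678, App. C, Prop. C.1 (consumer), §2.2
  (mollification estimates `‖∇(f ⋆ ψ_ℓ)‖₀ ≲ [f]_β ℓ^{β-1}`). [`BuckmasterEtAl2018`]
* M.-H. Giga, Y. Giga, J. Saal, *Nonlinear Partial Differential Equations* (2010), §1.1.3
  (derivative estimates for `e^{tΔ}`). [`GigaGigaSaal2010`]
* A. Lunardi, *Analytic Semigroups and Optimal Regularity in Parabolic Problems* (1995), §3.1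
  (Schauder estimates via the heat semigroup; the model for the splitting argument).
-/

noncomputable section

open MeasureTheory Set Filter Topology InnerProductSpace
open Literature.Analysis.UnboundedOperators
open scoped Real ENNReal NNReal Laplacian ContDiff

namespace Literature.Analysis.FluidPDE

namespace TorusHeat

/-! ## Abstract near-field calculus -/

section NearField

variable {X : Type*} [NormedAddCommGroup X]
variable {F : Type*} [NormedAddCommGroup F] [NormedSpace ℝ F]

/-- `σ ↦ σ^r` is integrable on `(0, b]` for `-1 < r`. [folklore] -/
theorem integrableOn_rpow_Ioc {r : ℝ} (hr : -1 < r) {b : ℝ} (hb : 0 ≤ b) :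
    IntegrableOn (fun σ : ℝ => σ ^ r) (Ioc 0 b) :=
  (intervalIntegrable_iff_integrableOn_Ioc_of_le hb).1 (intervalIntegral.intervalIntegrable_rpow' hr)

/-- `∫₀ᵇ σ^{γ-1} dσ = b^γ/γ` for `0 < γ`, `0 ≤ b`. [folklore] -/
theorem integral_rpow_sub_one_Ioc {γ : ℝ} (hγ : 0 < γ) {b : ℝ} (hb : 0 ≤ b) :
    ∫ σ in Ioc 0 b, σ ^ (γ - 1) = b ^ γ / γ := by
  rw [← intervalIntegral.integral_of_le hb, integral_rpow (Or.inl (by linarith))]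
  rw [show γ - 1 + 1 = γ by ring, Real.zero_rpow hγ.ne', sub_zero]

/-- A family integrable against `σ^{γ-1}`: if `σ ↦ Φ σ` is continuous on `(0, ∞)` and
`‖Φ σ‖ ≤ K σ^{γ-1}` on `(0, 1]` with `0 < γ`, then `Φ` is integrable on `(0, 1]` and
`‖∫₀¹ Φ‖ ≤ K/γ`. [folklore] -/
theorem norm_integral_Ioc_le_of_norm_le_rpow {Φ : ℝ → F} (hΦ : ContinuousOn Φ (Ioi 0)) {K γ : ℝ}
    (hγ : 0 < γ) (hb : ∀ σ ∈ Ioc (0 : ℝ) 1, ‖Φ σ‖ ≤ K * σ ^ (γ - 1)) :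
    IntegrableOn Φ (Ioc 0 1) ∧ ‖∫ σ in Ioc 0 1, Φ σ‖ ≤ K / γ := by
  have hmeas : AEStronglyMeasurable Φ (volume.restrict (Ioc (0 : ℝ) 1)) :=
    (hΦ.mono Ioc_subset_Ioi_self).aestronglyMeasurable measurableSet_Ioc
  have hmaj : IntegrableOn (fun σ : ℝ => K * σ ^ (γ - 1)) (Ioc 0 1) :=
    (integrableOn_rpow_Ioc (by linarith) zero_le_one).const_mul K
  have hae : ∀ᵐ σ ∂(volume.restrict (Ioc (0 : ℝ) 1)), ‖Φ σ‖ ≤ K * σ ^ (γ - 1) :=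
    (ae_restrict_iff' measurableSet_Ioc).2 (Eventually.of_forall hb)
  have hint : IntegrableOn Φ (Ioc 0 1) := Integrable.mono' hmaj hmeas hae
  refine ⟨hint, (norm_integral_le_of_norm_le hmaj hae).trans_eq ?_⟩
  rw [integral_const_mul, integral_rpow_sub_one_Ioc hγ zero_le_one, Real.one_rpow, mul_one_div]

/-- **The near-field Hölder estimate (abstract form).** Let `Φ : ℝ → X → F` satisfy, for
`σ ∈ (0,1]`: `σ ↦ Φ σ x` continuous on `(0, ∞)`, `‖Φ σ x‖ ≤ K σ^{β/2-1}` and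
`‖Φ σ x - Φ σ y‖ ≤ L σ^{(β-3)/2} ‖x - y‖`, with `0 < β < 1`, `0 ≤ K, L`. Then
`N x = ∫₀¹ Φ σ x dσ` satisfies `‖N x - N y‖ ≤ (4K/β + 2L/(1-β)) ‖x - y‖^β` (split the integral at
`σ = ‖x - y‖² ≤ 1`; Lunardi 1995, §3.1). [folklore] -/
theorem norm_integral_Ioc_sub_le_of_bounds {Φ : ℝ → X → F} {K L β : ℝ} (hβ0 : 0 < β) (hβ1 : β < 1)
    (hK : 0 ≤ K) (hL : 0 ≤ L) (hΦ : ∀ x, ContinuousOn (fun σ => Φ σ x) (Ioi 0))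
    (hb : ∀ σ ∈ Ioc (0 : ℝ) 1, ∀ x, ‖Φ σ x‖ ≤ K * σ ^ (β / 2 - 1))
    (hlip : ∀ σ ∈ Ioc (0 : ℝ) 1, ∀ x y, ‖Φ σ x - Φ σ y‖ ≤ L * σ ^ ((β - 3) / 2) * ‖x - y‖)
    (x y : X) :
    ‖(∫ σ in Ioc 0 1, Φ σ x) - ∫ σ in Ioc 0 1, Φ σ y‖ ≤
      (4 * K / β + 2 * L / (1 - β)) * ‖x - y‖ ^ β := by
  have hγ : 0 < β / 2 := by positivity
  have hb' : ∀ z, ∀ σ ∈ Ioc (0 : ℝ) 1, ‖Φ σ z‖ ≤ K * σ ^ (β / 2 - 1) := fun z σ hσ => hb σ hσ z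
  have hN : ∀ z, IntegrableOn (fun σ => Φ σ z) (Ioc 0 1) ∧ ‖∫ σ in Ioc 0 1, Φ σ z‖ ≤ K / (β / 2) :=
    fun z => norm_integral_Ioc_le_of_norm_le_rpow (hΦ z) hγ (hb' z)
  have hKβ : K / (β / 2) = 2 * K / β := by field_simp
  have hC1 : 0 ≤ 4 * K / β := by positivity
  have hC2 : 0 ≤ 2 * L / (1 - β) := div_nonneg (by positivity) (by linarith)
  set h : ℝ := ‖x - y‖ with hh_def
  have hh0 : 0 ≤ h := norm_nonneg _
  rcases le_or_gt h 1 with hle | hgt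
  · -- the case `h ≤ 1`
    rcases hh0.eq_or_lt with hzero | hpos
    · -- `x = y`
      have hxy : x = y := by rwa [eq_comm, hh_def, norm_sub_eq_zero_iff] at hzero
      subst hxy
      rw [sub_self, norm_zero]
      positivity
    -- `0 < h ≤ 1`: split at `s = h²`
    set s : ℝ := h ^ 2 with hs_def
    have hs0 : 0 < s := by positivity
    have hs1 : s ≤ 1 := by rw [hs_def]; nlinarith
    -- interval integrability of the difference on `[0, s]` and `[s, 1]`
    have hdiff : IntegrableOn (fun σ => Φ σ x - Φ σ y) (Ioc 0 1) := (hN x).1.sub (hN y).1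
    have hII : ∀ a b, 0 ≤ a → a ≤ b → b ≤ 1 →
        IntervalIntegrable (fun σ => Φ σ x - Φ σ y) volume a b := fun a b ha hab hb1 =>
      (intervalIntegrable_iff_integrableOn_Ioc_of_le hab).2 (hdiff.mono_set (Ioc_subset_Ioc ha hb1))
    have hsplit : (∫ σ in Ioc 0 1, Φ σ x) - ∫ σ in Ioc 0 1, Φ σ y =
        (∫ σ in (0 : ℝ)..s, (Φ σ x - Φ σ y)) + ∫ σ in s..1, (Φ σ x - Φ σ y) := by
      rw [intervalIntegral.integral_add_adjacent_intervals (hII 0 s le_rfl hs0.le hs1)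
        (hII s 1 hs0.le hs1 le_rfl), intervalIntegral.integral_of_le zero_le_one,
        integral_sub (hN x).1 (hN y).1]
    -- the piece `(0, s]`
    have h1 : ‖∫ σ in (0 : ℝ)..s, (Φ σ x - Φ σ y)‖ ≤ 4 * K / β * h ^ β := by
      have hbd : ∀ᵐ σ ∂volume, σ ∈ Ioc (0 : ℝ) s → ‖Φ σ x - Φ σ y‖ ≤ 2 * K * σ ^ (β / 2 - 1) := by
        refine Eventually.of_forall fun σ hσ => ?_
        have hσ1 : σ ∈ Ioc (0 : ℝ) 1 := ⟨hσ.1, hσ.2.trans hs1⟩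
        calc ‖Φ σ x - Φ σ y‖ ≤ ‖Φ σ x‖ + ‖Φ σ y‖ := norm_sub_le _ _
          _ ≤ K * σ ^ (β / 2 - 1) + K * σ ^ (β / 2 - 1) := add_le_add (hb σ hσ1 x) (hb σ hσ1 y)
          _ = 2 * K * σ ^ (β / 2 - 1) := by ring
      have hbi : IntervalIntegrable (fun σ : ℝ => 2 * K * σ ^ (β / 2 - 1)) volume 0 s :=
        (intervalIntegral.intervalIntegrable_rpow' (by linarith)).const_mul _
      calc ‖∫ σ in (0 : ℝ)..s, (Φ σ x - Φ σ y)‖ ≤ ∫ σ in (0 : ℝ)..s, 2 * K * σ ^ (β / 2 - 1) :=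
            intervalIntegral.norm_integral_le_of_norm_le hs0.le hbd hbi
        _ = 2 * K * (s ^ (β / 2) / (β / 2)) := by
            rw [intervalIntegral.integral_const_mul, intervalIntegral.integral_of_le hs0.le,
              integral_rpow_sub_one_Ioc hγ hs0.le]
        _ = 4 * K / β * h ^ β := by
            have : s ^ (β / 2) = h ^ β := by
              rw [hs_def, ← Real.rpow_natCast, ← Real.rpow_mul hh0]
              congr 1
              push_cast
              ring
            rw [this]
            field_simp
            ring
    -- the piece `(s, 1]`
    have h2 : ‖∫ σ in s..1, (Φ σ x - Φ σ y)‖ ≤ 2 * L / (1 - β) * h ^ β := by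
      have hbd : ∀ᵐ σ ∂volume, σ ∈ Ioc s 1 → ‖Φ σ x - Φ σ y‖ ≤ L * h * σ ^ ((β - 3) / 2) := by
        refine Eventually.of_forall fun σ hσ => ?_
        have hσ1 : σ ∈ Ioc (0 : ℝ) 1 := ⟨hs0.trans hσ.1, hσ.2⟩
        calc ‖Φ σ x - Φ σ y‖ ≤ L * σ ^ ((β - 3) / 2) * ‖x - y‖ := hlip σ hσ1 x y
          _ = L * h * σ ^ ((β - 3) / 2) := by rw [← hh_def]; ring
      have hr1 : (β - 3) / 2 ≠ -1 := by intro h'; linarith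
      have h0notin : (0 : ℝ) ∉ uIcc s 1 := by
        rw [uIcc_of_le hs1]
        exact fun h0 => (lt_irrefl _ (hs0.trans_le h0.1)).elim
      have hbi : IntervalIntegrable (fun σ : ℝ => L * h * σ ^ ((β - 3) / 2)) volume s 1 :=
        (intervalIntegral.intervalIntegrable_rpow (Or.inr h0notin)).const_mul _
      have hint_rpow : ∫ σ in s..1, σ ^ ((β - 3) / 2) = (1 - s ^ ((β - 1) / 2)) / ((β - 1) / 2) := by
        rw [integral_rpow (Or.inr ⟨hr1, h0notin⟩), show (β - 3) / 2 + 1 = (β - 1) / 2 by ring,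
          Real.one_rpow]
      have hsh : s ^ ((β - 1) / 2) = h ^ (β - 1) := by
        rw [hs_def, ← Real.rpow_natCast, ← Real.rpow_mul hh0]
        congr 1
        push_cast
        ring
      have hhh : h * h ^ (β - 1) = h ^ β := by
        rw [Real.rpow_sub_one hpos.ne', mul_div_cancel₀ _ hpos.ne']
      have h1β : 0 < 1 - β := by linarith
      have hne1 : (1 - β) ≠ 0 := h1β.ne'
      have hne2 : (β - 1) / 2 ≠ 0 := by
        intro h'
        apply hne1
        linarith
      have hne3 : β - 1 ≠ 0 := (by linarith : β - 1 < 0).ne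
      have hquot : ∀ t : ℝ, (1 - t) / ((β - 1) / 2) = 2 / (1 - β) * (t - 1) := fun t => by
        rw [div_div_eq_mul_div, div_mul_eq_mul_div, div_eq_div_iff hne3 hne1]
        ring
      calc ‖∫ σ in s..1, (Φ σ x - Φ σ y)‖ ≤ ∫ σ in s..1, L * h * σ ^ ((β - 3) / 2) :=
            intervalIntegral.norm_integral_le_of_norm_le hs1 hbd hbi
        _ = L * h * ((1 - s ^ ((β - 1) / 2)) / ((β - 1) / 2)) := by
            rw [intervalIntegral.integral_const_mul, hint_rpow]
        _ = 2 * L / (1 - β) * (h * h ^ (β - 1) - h) := by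
            rw [hsh, hquot]
            ring
        _ ≤ 2 * L / (1 - β) * (h * h ^ (β - 1)) := by
            refine mul_le_mul_of_nonneg_left (by linarith) hC2
        _ = 2 * L / (1 - β) * h ^ β := by rw [hhh]
    calc ‖(∫ σ in Ioc 0 1, Φ σ x) - ∫ σ in Ioc 0 1, Φ σ y‖
        = ‖(∫ σ in (0 : ℝ)..s, (Φ σ x - Φ σ y)) + ∫ σ in s..1, (Φ σ x - Φ σ y)‖ := by rw [hsplit]
      _ ≤ ‖∫ σ in (0 : ℝ)..s, (Φ σ x - Φ σ y)‖ + ‖∫ σ in s..1, (Φ σ x - Φ σ y)‖ := norm_add_le _ _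
      _ ≤ 4 * K / β * h ^ β + 2 * L / (1 - β) * h ^ β := add_le_add h1 h2
      _ = (4 * K / β + 2 * L / (1 - β)) * h ^ β := by ring
  · -- the case `h > 1`: crude bound by the sup norms
    have h1h : 1 ≤ h ^ β := Real.one_le_rpow hgt.le hβ0.le
    calc ‖(∫ σ in Ioc 0 1, Φ σ x) - ∫ σ in Ioc 0 1, Φ σ y‖
        ≤ ‖∫ σ in Ioc 0 1, Φ σ x‖ + ‖∫ σ in Ioc 0 1, Φ σ y‖ := norm_sub_le _ _
      _ ≤ 2 * K / β + 2 * K / β := by rw [← hKβ]; exact add_le_add (hN x).2 (hN y).2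
      _ = (4 * K / β) * 1 := by ring
      _ ≤ (4 * K / β + 2 * L / (1 - β)) * h ^ β :=
          mul_le_mul (le_add_of_nonneg_right hC2) h1h zero_le_one (add_nonneg hC1 hC2)

end NearField

/-! ## Second-order smoothing bounds and the far field -/

section Smoothing

variable {d : Type*} [Fintype d]
variable {F : Type*} [NormedAddCommGroup F] [NormedSpace ℝ F] [CompleteSpace F]

/-- **Second-order smoothing bound, bounded data**: for a smooth torus function `g` with `‖g‖ ≤ B`,
`‖e^{2aΔ} (∂₁∂₂ g)~ (x)‖ ≤ (2^{n/2} a^{-1/2})² B ‖v₁‖ ‖v₂‖` (two smoothing steps,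
`e^{2aΔ} = e^{aΔ}e^{aΔ}`). [cite: GigaGigaSaal2010, §1.1.3] -/
theorem norm_heatExtension_lift_lineDeriv₂_le_of_bound {g : UnitAddTorus d → F}
    (hg : FunctionSpaces.Torus.IsSmooth g) {B : ℝ} (hB : ∀ z, ‖g z‖ ≤ B) {a : ℝ} (ha : 0 < a)
    (x v₁ v₂ : EuclideanSpace ℝ d) :
    ‖heatExtension (FunctionSpaces.Torus.lift (fun z => FunctionSpaces.Torus.lineDeriv
        (fun z' => FunctionSpaces.Torus.lineDeriv g z' v₂) z v₁)) (a + a) x‖ ≤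
      (2 : ℝ) ^ ((Module.finrank ℝ (EuclideanSpace ℝ d) : ℝ) / 2) * a ^ (-(1 / 2 : ℝ)) *
        ((2 : ℝ) ^ ((Module.finrank ℝ (EuclideanSpace ℝ d) : ℝ) / 2) * a ^ (-(1 / 2 : ℝ)) * B * ‖v₂‖) *
          ‖v₁‖ :=
  norm_heatExtension_lift_lineDeriv_le_step (hg.lineDeriv v₂) ha ha
    (fun y => norm_heatExtension_lift_lineDeriv_le_of_bound hg hB ha y v₂) x v₁

/-- **Second-order smoothing bound, Hölder data**: for a smooth torus function `g` with
`‖g̃ y - g̃ z‖ ≤ A ‖y - z‖^β` (`0 ≤ β ≤ 1`),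
`‖e^{2aΔ} (∂₁∂₂ g)~ (x)‖ ≤ (2^{n/2} a^{-1/2})² (1+2·2^{n/2}) (2a)^{β/2} A ‖v₁‖ ‖v₂‖`, i.e.
`≲ a^{β/2-1} [g]_β`. [cite: BuckmasterEtAl2018, §2.2 (standard mollification estimates)] -/
theorem norm_heatExtension_lift_lineDeriv₂_le_of_holder {g : UnitAddTorus d → F}
    (hg : FunctionSpaces.Torus.IsSmooth g) {A β : ℝ} (hA : 0 ≤ A) (hβ0 : 0 ≤ β) (hβ1 : β ≤ 1)
    (hH : ∀ y z, ‖FunctionSpaces.Torus.lift g y - FunctionSpaces.Torus.lift g z‖ ≤ A * ‖y - z‖ ^ β)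
    {a : ℝ} (ha : 0 < a) (x v₁ v₂ : EuclideanSpace ℝ d) :
    ‖heatExtension (FunctionSpaces.Torus.lift (fun z => FunctionSpaces.Torus.lineDeriv
        (fun z' => FunctionSpaces.Torus.lineDeriv g z' v₂) z v₁)) (a + a) x‖ ≤
      (2 : ℝ) ^ ((Module.finrank ℝ (EuclideanSpace ℝ d) : ℝ) / 2) * a ^ (-(1 / 2 : ℝ)) *
        ((2 : ℝ) ^ ((Module.finrank ℝ (EuclideanSpace ℝ d) : ℝ) / 2) * a ^ (-(1 / 2 : ℝ)) *
          ((1 + 2 * (2 : ℝ) ^ ((Module.finrank ℝ (EuclideanSpace ℝ d) : ℝ) / 2)) * (2 * a) ^ (β / 2)) *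
            A * ‖v₂‖) * ‖v₁‖ :=
  norm_heatExtension_lift_lineDeriv_le_step (hg.lineDeriv v₂) ha ha
    (fun y => norm_heatExtension_lift_lineDeriv_le_of_holder hg hA hβ0 hβ1 hH ha y v₂) x v₁

/-- `((1/2)^{-1/2})² = 2`. [folklore] -/
theorem rpow_half_aux : ((1 / 2 : ℝ) ^ (-(1 / 2 : ℝ))) ^ 2 = 2 := by
  rw [← Real.rpow_natCast, ← Real.rpow_mul (by norm_num)]
  norm_num

/-- `((σ/2)^{-1/2})² (2 (σ/2))^{β/2} = 2 σ^{β/2-1}` for `0 < σ`. [folklore] -/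
theorem rpow_div_two_aux {σ : ℝ} (hσ : 0 < σ) (β : ℝ) :
    ((σ / 2) ^ (-(1 / 2 : ℝ))) ^ 2 * (2 * (σ / 2)) ^ (β / 2) = 2 * σ ^ (β / 2 - 1) := by
  have hσ2 : 0 < σ / 2 := by positivity
  rw [← Real.rpow_natCast, ← Real.rpow_mul hσ2.le, mul_div_cancel₀ _ (two_ne_zero' ℝ)]
  norm_num
  rw [Real.rpow_neg hσ2.le, Real.rpow_one, Real.rpow_sub hσ, Real.rpow_one]
  field_simp

/-- **The far field is bounded**: for a smooth torus function `u` with `‖u‖ ≤ B`,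
`‖e^{1·Δ} (∂₁∂₂ u)~ (x)‖ ≤ 2 · 2^{n} B ‖v₁‖ ‖v₂‖`. [cite: GigaGigaSaal2010, §1.1.3] -/
theorem norm_heatExtension_one_lift_lineDeriv₂_le {u : UnitAddTorus d → F}
    (hu : FunctionSpaces.Torus.IsSmooth u) {B : ℝ} (hB : ∀ z, ‖u z‖ ≤ B) (x v₁ v₂ : EuclideanSpace ℝ d) :
    ‖heatExtension (FunctionSpaces.Torus.lift (fun z => FunctionSpaces.Torus.lineDeriv
        (fun z' => FunctionSpaces.Torus.lineDeriv u z' v₂) z v₁)) 1 x‖ ≤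
      2 * ((2 : ℝ) ^ ((Module.finrank ℝ (EuclideanSpace ℝ d) : ℝ) / 2)) ^ 2 * B * ‖v₁‖ * ‖v₂‖ := by
  have h := norm_heatExtension_lift_lineDeriv₂_le_of_bound hu hB (a := 1 / 2) (by norm_num) x v₁ v₂
  rw [show (1 / 2 : ℝ) + 1 / 2 = 1 by norm_num] at h
  refine h.trans_eq ?_
  rw [show ∀ c r b n₁ n₂ : ℝ, c * r * (c * r * b * n₂) * n₁ = r ^ 2 * c ^ 2 * b * n₁ * n₂ from
    fun c r b n₁ n₂ => by ring, rpow_half_aux]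

/-- **The far field is Lipschitz**: for a smooth torus function `u` with `‖u‖ ≤ B`, the function
`e^{1·Δ} (∂₁∂₂ u)~` has derivative bounded by `3^{3/2} 2^{3n/2} B ‖v₁‖ ‖v₂‖`, hence
`‖e^{Δ}(∂₁∂₂u)~(x) - e^{Δ}(∂₁∂₂u)~(y)‖ ≤ 3^{3/2} 2^{3n/2} B ‖v₁‖ ‖v₂‖ ‖x - y‖`.
[cite: GigaGigaSaal2010, §1.1.3] -/
theorem norm_heatExtension_one_lift_lineDeriv₂_sub_le {u : UnitAddTorus d → F}
    (hu : FunctionSpaces.Torus.IsSmooth u) {B : ℝ} (hB : ∀ z, ‖u z‖ ≤ B) (v₁ v₂ x y : EuclideanSpace ℝ d) :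
    ‖heatExtension (FunctionSpaces.Torus.lift (fun z => FunctionSpaces.Torus.lineDeriv
        (fun z' => FunctionSpaces.Torus.lineDeriv u z' v₂) z v₁)) 1 x -
      heatExtension (FunctionSpaces.Torus.lift (fun z => FunctionSpaces.Torus.lineDeriv
        (fun z' => FunctionSpaces.Torus.lineDeriv u z' v₂) z v₁)) 1 y‖ ≤
      (3 : ℝ) ^ ((3 : ℝ) / 2) * ((2 : ℝ) ^ ((Module.finrank ℝ (EuclideanSpace ℝ d) : ℝ) / 2)) ^ 3 * B *
        ‖v₁‖ * ‖v₂‖ * ‖x - y‖ := by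
  set c : ℝ := (2 : ℝ) ^ ((Module.finrank ℝ (EuclideanSpace ℝ d) : ℝ) / 2) with hc
  set g : UnitAddTorus d → F := fun z => FunctionSpaces.Torus.lineDeriv
    (fun z' => FunctionSpaces.Torus.lineDeriv u z' v₂) z v₁ with hg_def
  have hg : FunctionSpaces.Torus.IsSmooth g := (hu.lineDeriv v₂).lineDeriv v₁
  set P : EuclideanSpace ℝ d → F := heatExtension (FunctionSpaces.Torus.lift g) 1 with hP
  have hPd : ∀ z, DifferentiableAt ℝ P z := fun z =>
    ((contDiff_heatExtension_lift hg.continuous one_pos (m := 1)).differentiable one_ne_zero) z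
  have hB0 : 0 ≤ B := (norm_nonneg _).trans (hB 0)
  have hbound : ∀ z, ‖fderiv ℝ P z‖ ≤ (3 : ℝ) ^ ((3 : ℝ) / 2) * c ^ 3 * B * ‖v₁‖ * ‖v₂‖ := by
    intro z
    refine ContinuousLinearMap.opNorm_le_bound _ (by positivity) fun v => ?_
    rw [hP, fderiv_heatExtension_lift_apply hg one_pos z v]
    have h13 : (0 : ℝ) < 1 / 3 := by norm_num
    have h := norm_heatExtension_lift_lineDeriv₃_le_of_bound hu hB h13 z v v₁ v₂
    rw [show (1 / 3 : ℝ) + 1 / 3 + 1 / 3 = 1 by norm_num, ← hc] at h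
    refine h.trans_eq ?_
    have h3 : ((1 / 3 : ℝ) ^ (-(1 / 2 : ℝ))) ^ 3 = (3 : ℝ) ^ ((3 : ℝ) / 2) := by
      have := rpow_div_three_aux one_pos
      rwa [Real.one_rpow, mul_one] at this
    calc c * (1 / 3 : ℝ) ^ (-(1 / 2 : ℝ)) * (c * (1 / 3 : ℝ) ^ (-(1 / 2 : ℝ)) *
          (c * (1 / 3 : ℝ) ^ (-(1 / 2 : ℝ)) * B * ‖v₂‖) * ‖v₁‖) * ‖v‖
        = ((1 / 3 : ℝ) ^ (-(1 / 2 : ℝ))) ^ 3 * c ^ 3 * B * ‖v₁‖ * ‖v₂‖ * ‖v‖ := by ring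
      _ = (3 : ℝ) ^ ((3 : ℝ) / 2) * c ^ 3 * B * ‖v₁‖ * ‖v₂‖ * ‖v‖ := by rw [h3]
  have := Convex.norm_image_sub_le_of_norm_fderiv_le (fun z _ => hPd z) (fun z _ => hbound z)
    convex_univ (mem_univ y) (mem_univ x)
  exact this

end Smoothing

/-! ## The near field for Hölder data -/

section NearHeat

variable {d : Type*} [Fintype d]
variable {F : Type*} [NormedAddCommGroup F] [NormedSpace ℝ F] [CompleteSpace F]

/-- **Near-field size**: for smooth `f` with `‖f̃ y - f̃ z‖ ≤ A ‖y - z‖^β` (`0 ≤ β ≤ 1`) and `0 < σ`,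
`‖e^{σΔ} (∂₁∂₂ f)~ (x)‖ ≤ 2·2^{n} (1+2·2^{n/2}) A ‖v₁‖ ‖v₂‖ σ^{β/2-1}`.
[cite: BuckmasterEtAl2018, §2.2 (standard mollification estimates)] -/
theorem norm_heatExtension_lift_lineDeriv₂_le_rpow {f : UnitAddTorus d → F}
    (hf : FunctionSpaces.Torus.IsSmooth f) {A β : ℝ} (hA : 0 ≤ A) (hβ0 : 0 ≤ β) (hβ1 : β ≤ 1)
    (hH : ∀ y z, ‖FunctionSpaces.Torus.lift f y - FunctionSpaces.Torus.lift f z‖ ≤ A * ‖y - z‖ ^ β)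
    {σ : ℝ} (hσ : 0 < σ) (x v₁ v₂ : EuclideanSpace ℝ d) :
    ‖heatExtension (FunctionSpaces.Torus.lift (fun z => FunctionSpaces.Torus.lineDeriv
        (fun z' => FunctionSpaces.Torus.lineDeriv f z' v₂) z v₁)) σ x‖ ≤
      2 * ((2 : ℝ) ^ ((Module.finrank ℝ (EuclideanSpace ℝ d) : ℝ) / 2)) ^ 2 *
        (1 + 2 * (2 : ℝ) ^ ((Module.finrank ℝ (EuclideanSpace ℝ d) : ℝ) / 2)) * A * ‖v₁‖ * ‖v₂‖ *
          σ ^ (β / 2 - 1) := by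
  have hσ2 : 0 < σ / 2 := by positivity
  have h := norm_heatExtension_lift_lineDeriv₂_le_of_holder hf hA hβ0 hβ1 hH hσ2 x v₁ v₂
  rw [show σ / 2 + σ / 2 = σ by ring] at h
  refine h.trans_eq ?_
  rw [show ∀ c r cH p a n₁ n₂ : ℝ, c * r * (c * r * (cH * p) * a * n₂) * n₁ =
      c ^ 2 * cH * a * n₁ * n₂ * (r ^ 2 * p) from fun c r cH p a n₁ n₂ => by ring,
    rpow_div_two_aux hσ β]
  ring

/-- **Near-field gradient**: for smooth `f` with `‖f̃ y - f̃ z‖ ≤ A ‖y - z‖^β` (`0 ≤ β ≤ 1`) and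
`0 < σ`, the function `e^{σΔ} (∂₁∂₂ f)~` is Lipschitz with constant
`3^{3/2} 2^{3n/2} (1+2·2^{n/2}) (2/3)^{β/2} A ‖v₁‖ ‖v₂‖ σ^{(β-3)/2}` (third-order smoothing bound and
the mean value inequality). [cite: BuckmasterEtAl2018, §2.2 (standard mollification estimates)] -/
theorem norm_heatExtension_lift_lineDeriv₂_sub_le_rpow {f : UnitAddTorus d → F}
    (hf : FunctionSpaces.Torus.IsSmooth f) {A β : ℝ} (hA : 0 ≤ A) (hβ0 : 0 ≤ β) (hβ1 : β ≤ 1)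
    (hH : ∀ y z, ‖FunctionSpaces.Torus.lift f y - FunctionSpaces.Torus.lift f z‖ ≤ A * ‖y - z‖ ^ β)
    {σ : ℝ} (hσ : 0 < σ) (v₁ v₂ x y : EuclideanSpace ℝ d) :
    ‖heatExtension (FunctionSpaces.Torus.lift (fun z => FunctionSpaces.Torus.lineDeriv
        (fun z' => FunctionSpaces.Torus.lineDeriv f z' v₂) z v₁)) σ x -
      heatExtension (FunctionSpaces.Torus.lift (fun z => FunctionSpaces.Torus.lineDeriv
        (fun z' => FunctionSpaces.Torus.lineDeriv f z' v₂) z v₁)) σ y‖ ≤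
      ((3 : ℝ) ^ ((3 : ℝ) / 2) * ((2 : ℝ) ^ ((Module.finrank ℝ (EuclideanSpace ℝ d) : ℝ) / 2)) ^ 3 *
        (1 + 2 * (2 : ℝ) ^ ((Module.finrank ℝ (EuclideanSpace ℝ d) : ℝ) / 2)) *
          ((2 : ℝ) ^ (β / 2) / (3 : ℝ) ^ (β / 2)) * A * ‖v₁‖ * ‖v₂‖) * σ ^ ((β - 3) / 2) * ‖x - y‖ := by
  set c : ℝ := (2 : ℝ) ^ ((Module.finrank ℝ (EuclideanSpace ℝ d) : ℝ) / 2) with hc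
  set cH : ℝ := 1 + 2 * (2 : ℝ) ^ ((Module.finrank ℝ (EuclideanSpace ℝ d) : ℝ) / 2) with hcH
  set g : UnitAddTorus d → F := fun z => FunctionSpaces.Torus.lineDeriv
    (fun z' => FunctionSpaces.Torus.lineDeriv f z' v₂) z v₁ with hg_def
  have hg : FunctionSpaces.Torus.IsSmooth g := (hf.lineDeriv v₂).lineDeriv v₁
  set P : EuclideanSpace ℝ d → F := heatExtension (FunctionSpaces.Torus.lift g) σ with hP
  have hPd : ∀ z, DifferentiableAt ℝ P z := fun z =>
    ((contDiff_heatExtension_lift hg.continuous hσ (m := 1)).differentiable one_ne_zero) z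
  have hK0 : 0 ≤ (3 : ℝ) ^ ((3 : ℝ) / 2) * c ^ 3 * cH * ((2 : ℝ) ^ (β / 2) / (3 : ℝ) ^ (β / 2)) * A *
      ‖v₁‖ * ‖v₂‖ * σ ^ ((β - 3) / 2) := by positivity
  have hbound : ∀ z, ‖fderiv ℝ P z‖ ≤ (3 : ℝ) ^ ((3 : ℝ) / 2) * c ^ 3 * cH *
      ((2 : ℝ) ^ (β / 2) / (3 : ℝ) ^ (β / 2)) * A * ‖v₁‖ * ‖v₂‖ * σ ^ ((β - 3) / 2) := by
    intro z
    refine ContinuousLinearMap.opNorm_le_bound _ hK0 fun v => ?_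
    rw [hP, fderiv_heatExtension_lift_apply hg hσ z v]
    have h3 : 0 < σ / 3 := by positivity
    have h := norm_heatExtension_lift_lineDeriv₃_le_of_holder hf hA hβ0 hβ1 hH h3 z v v₁ v₂
    rw [show σ / 3 + σ / 3 + σ / 3 = σ by ring, ← hc, ← hcH] at h
    refine h.trans_eq ?_
    calc c * (σ / 3) ^ (-(1 / 2 : ℝ)) * (c * (σ / 3) ^ (-(1 / 2 : ℝ)) *
          (c * (σ / 3) ^ (-(1 / 2 : ℝ)) * (cH * (2 * (σ / 3)) ^ (β / 2)) * A * ‖v₂‖) * ‖v₁‖) * ‖v‖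
        = c ^ 3 * cH * ((2 * (σ / 3)) ^ (β / 2) * ((σ / 3) ^ (-(1 / 2 : ℝ))) ^ 3) * A * ‖v₁‖ * ‖v₂‖ *
            ‖v‖ := by ring
      _ = (3 : ℝ) ^ ((3 : ℝ) / 2) * c ^ 3 * cH * ((2 : ℝ) ^ (β / 2) / (3 : ℝ) ^ (β / 2)) * A *
            ‖v₁‖ * ‖v₂‖ * σ ^ ((β - 3) / 2) * ‖v‖ := by
          rw [rpow_div_three_aux' hσ β]; ring
  have := Convex.norm_image_sub_le_of_norm_fderiv_le (fun z _ => hPd z) (fun z _ => hbound z)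
    convex_univ (mem_univ y) (mem_univ x)
  exact this

end NearHeat

/-! ## The representation `g̃ = e^{Δ}g̃ - ∫₀¹ e^{σΔ}(Δg)~ dσ` -/

section Representation

variable {d : Type*} [Fintype d]
variable {F : Type*} [NormedAddCommGroup F] [NormedSpace ℝ F] [CompleteSpace F]

omit [CompleteSpace F] in
/-- The Laplacian of the lift is the lift of the torus Laplacian (functional form of
`Torus.laplacian_lift`). [folklore] -/
theorem laplacian_lift_eq (g : UnitAddTorus d → F) :
    Δ (FunctionSpaces.Torus.lift g) = FunctionSpaces.Torus.lift (FunctionSpaces.Torus.laplacian g) := by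
  funext y
  rw [FunctionSpaces.Torus.lift_apply, FunctionSpaces.Torus.laplacian, FunctionSpaces.Torus.liftAt_proj,
    InnerProductSpace.laplacian_eq_iteratedFDeriv_stdOrthonormalBasis,
    InnerProductSpace.laplacian_eq_iteratedFDeriv_stdOrthonormalBasis]
  simp only [Function.comp_def, iteratedFDeriv_comp_add_left, add_zero]

/-- **Representation through the heat flow.** Let `g, Ψ` be smooth on `T^d` with `Δg = Ψ`, and
suppose `σ ↦ e^{σΔ} Ψ̃ (x)` is integrable on `(0, 1]`. Then
`g̃ (x) = e^{1·Δ} g̃ (x) - ∫₀¹ e^{σΔ} Ψ̃ (x) dσ`: the time fundamental theorem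
`e^{1Δ}g̃ - e^{aΔ}g̃ = ∫ₐ¹ Δ e^{σΔ} g̃ dσ` (`heatExtension_sub_eq_integral_laplacian`),
`Δ e^{σΔ} g̃ = e^{σΔ} (Δg)~` (`laplacian_heatExtension_lift`), and `e^{aΔ} g̃ (x) → g̃ (x)` as
`a → 0⁺` (`tendsto_heatExtension_nhdsGT_zero_of_continuousAt`). [folklore] -/
theorem lift_eq_heatExtension_one_sub_integral {g Ψ : UnitAddTorus d → F}
    (hg : FunctionSpaces.Torus.IsSmooth g) (hΔ : ∀ z, FunctionSpaces.Torus.laplacian g z = Ψ z)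
    (x : EuclideanSpace ℝ d)
    (hint : IntegrableOn (fun σ => heatExtension (FunctionSpaces.Torus.lift Ψ) σ x) (Ioc 0 1)) :
    FunctionSpaces.Torus.lift g x =
      heatExtension (FunctionSpaces.Torus.lift g) 1 x -
        ∫ σ in Ioc 0 1, heatExtension (FunctionSpaces.Torus.lift Ψ) σ x := by
  set Θ : ℝ → F := fun σ => heatExtension (FunctionSpaces.Torus.lift Ψ) σ x with hΘ
  have hmem : MemLp (FunctionSpaces.Torus.lift g) ∞ (volume : Measure (EuclideanSpace ℝ d)) :=
    memLp_top_lift hg.continuous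
  have hΨ : Ψ = FunctionSpaces.Torus.laplacian g := funext fun z => (hΔ z).symm
  have hlap : ∀ σ, 0 < σ → (Δ (heatExtension (FunctionSpaces.Torus.lift g) σ)) x = Θ σ := by
    intro σ hσ
    rw [laplacian_heatExtension_lift hg hσ x, laplacian_lift_eq, hΘ, hΨ]
  -- time FTC on `[a, 1]`
  have hFTC : ∀ a ∈ Ioc (0 : ℝ) 1, heatExtension (FunctionSpaces.Torus.lift g) 1 x -
      heatExtension (FunctionSpaces.Torus.lift g) a x = ∫ σ in a..1, Θ σ := by
    intro a ha
    rw [heatExtension_sub_eq_integral_laplacian hmem le_top ha.1 ha.2 x]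
    refine intervalIntegral.integral_congr fun σ hσ => ?_
    rw [uIcc_of_le ha.2] at hσ
    exact hlap σ (ha.1.trans_le hσ.1)
  -- interval integrability of `Θ` on subintervals of `[0, 1]`
  have hII : ∀ a b, 0 ≤ a → a ≤ b → b ≤ 1 → IntervalIntegrable Θ volume a b := fun a b ha hab hb1 =>
    (intervalIntegrable_iff_integrableOn_Ioc_of_le hab).2 (hint.mono_set (Ioc_subset_Ioc ha hb1))
  -- the primitive `a ↦ ∫₀ᵃ Θ` is continuous on `[0, 1]`, hence tends to `0` as `a → 0⁺`
  have hprim : ContinuousOn (fun a => ∫ σ in (0 : ℝ)..a, Θ σ) (uIcc 0 1) := by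
    refine intervalIntegral.continuousOn_primitive_interval ?_
    rw [uIcc_of_le zero_le_one, integrableOn_Icc_iff_integrableOn_Ioc]
    exact hint
  have hprim0 : Tendsto (fun a => ∫ σ in (0 : ℝ)..a, Θ σ) (𝓝[>] 0) (𝓝 0) := by
    have h0 : (0 : ℝ) ∈ uIcc (0 : ℝ) 1 := by rw [uIcc_of_le zero_le_one]; exact ⟨le_rfl, zero_le_one⟩
    have h := (hprim 0 h0).tendsto
    rw [intervalIntegral.integral_same] at h
    have hsub : Ioc (0 : ℝ) 1 ⊆ uIcc 0 1 := by rw [uIcc_of_le zero_le_one]; exact Ioc_subset_Icc_self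
    have h' := h.mono_left (nhdsWithin_mono _ hsub)
    rwa [nhdsWithin_Ioc_eq_nhdsGT zero_lt_one] at h'
  -- `e^{aΔ} g̃ (x) → g̃ (x)`
  have hlim1 : Tendsto (fun a => heatExtension (FunctionSpaces.Torus.lift g) a x) (𝓝[>] 0)
      (𝓝 (FunctionSpaces.Torus.lift g x)) :=
    tendsto_heatExtension_nhdsGT_zero_of_continuousAt hmem le_top
      (FunctionSpaces.Torus.continuous_lift_iff.2 hg.continuous).continuousAt
  -- `e^{aΔ} g̃ (x) = e^{Δ} g̃ (x) - (∫₀¹ Θ - ∫₀ᵃ Θ)` for `a ∈ (0, 1]`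
  have heq : ∀ᶠ a in 𝓝[>] (0 : ℝ), heatExtension (FunctionSpaces.Torus.lift g) 1 x -
      ((∫ σ in (0 : ℝ)..1, Θ σ) - ∫ σ in (0 : ℝ)..a, Θ σ) =
        heatExtension (FunctionSpaces.Torus.lift g) a x := by
    filter_upwards [Ioc_mem_nhdsGT zero_lt_one] with a ha
    rw [← intervalIntegral.integral_add_adjacent_intervals (hII 0 a le_rfl ha.1.le ha.2)
      (hII a 1 ha.1.le ha.2 le_rfl), ← hFTC a ha]
    abel
  have hlim2 : Tendsto (fun a => heatExtension (FunctionSpaces.Torus.lift g) 1 x -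
      ((∫ σ in (0 : ℝ)..1, Θ σ) - ∫ σ in (0 : ℝ)..a, Θ σ)) (𝓝[>] 0)
      (𝓝 (heatExtension (FunctionSpaces.Torus.lift g) 1 x - ((∫ σ in (0 : ℝ)..1, Θ σ) - 0))) :=
    tendsto_const_nhds.sub (tendsto_const_nhds.sub hprim0)
  have huniq := tendsto_nhds_unique (hlim2.congr' heq) hlim1
  rw [sub_zero, intervalIntegral.integral_of_le zero_le_one] at huniq
  exact huniq.symm

end Representation

/-! ## The Hölder estimate -/

section HolderEstimate

variable {F : Type*} [NormedAddCommGroup F] [NormedSpace ℝ F] [CompleteSpace F]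

/-- **Interior Hölder estimate for second derivatives through the heat semigroup.** For
`0 < β < 1` there is `K = K(d, β) ≥ 0` such that: whenever `u, f` are smooth on `T^d`, the second
derivative `g = ∂_{v₁}∂_{v₂} u` satisfies `Δg = ∂_{v₁}∂_{v₂} f` on `T^d`, `‖u‖ ≤ B` and
`‖f̃ y - f̃ z‖ ≤ A ‖y - z‖^β`, then
`‖g̃ (x)‖ ≤ K (B + A) ‖v₁‖ ‖v₂‖` and `‖g̃ (x) - g̃ (y)‖ ≤ K (B + A) ‖v₁‖ ‖v₂‖ ‖x - y‖^β`.
For `u = Δ⁻¹f` on `T³` this is the `C^α` boundedness of `∂ᵢ∂ⱼΔ⁻¹` (BDSV 2019, App. C,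
Prop. C.1), with `sup|Δ⁻¹f| ≲ sup|f|`. Proof: `g̃ = e^{Δ}g̃ - ∫₀¹ e^{σΔ}(∂_{v₁}∂_{v₂}f)~ dσ`
(`lift_eq_heatExtension_one_sub_integral`), the far-field bounds
`norm_heatExtension_one_lift_lineDeriv₂_le`, `…_sub_le` and the near-field bounds
`norm_heatExtension_lift_lineDeriv₂_le_rpow`, `…_sub_le_rpow` fed into
`norm_integral_Ioc_sub_le_of_bounds`. [cite: BuckmasterEtAl2018, App. C Prop. C.1] -/
theorem exists_holder_bound_lineDeriv₂ (d : Type*) [Fintype d] {β : ℝ} (hβ0 : 0 < β) (hβ1 : β < 1) :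
    ∃ K : ℝ, 0 ≤ K ∧
      ∀ {u f : UnitAddTorus d → F} (_hu : FunctionSpaces.Torus.IsSmooth u)
        (_hf : FunctionSpaces.Torus.IsSmooth f) (v₁ v₂ : EuclideanSpace ℝ d)
        (_hΔ : ∀ z, FunctionSpaces.Torus.laplacian (fun z => FunctionSpaces.Torus.lineDeriv
            (fun z' => FunctionSpaces.Torus.lineDeriv u z' v₂) z v₁) z =
          FunctionSpaces.Torus.lineDeriv (fun z' => FunctionSpaces.Torus.lineDeriv f z' v₂) z v₁)
        {B : ℝ} (_hB : ∀ z, ‖u z‖ ≤ B) {A : ℝ} (_hA : 0 ≤ A)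
        (_hH : ∀ y z, ‖FunctionSpaces.Torus.lift f y - FunctionSpaces.Torus.lift f z‖ ≤ A * ‖y - z‖ ^ β),
        (∀ x, ‖FunctionSpaces.Torus.lift (fun z => FunctionSpaces.Torus.lineDeriv
            (fun z' => FunctionSpaces.Torus.lineDeriv u z' v₂) z v₁) x‖ ≤ K * (B + A) * ‖v₁‖ * ‖v₂‖) ∧
        (∀ x y, ‖FunctionSpaces.Torus.lift (fun z => FunctionSpaces.Torus.lineDeriv
            (fun z' => FunctionSpaces.Torus.lineDeriv u z' v₂) z v₁) x -
          FunctionSpaces.Torus.lift (fun z => FunctionSpaces.Torus.lineDeriv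
            (fun z' => FunctionSpaces.Torus.lineDeriv u z' v₂) z v₁) y‖ ≤
            K * (B + A) * ‖v₁‖ * ‖v₂‖ * ‖x - y‖ ^ β) := by
  -- the constants
  set c : ℝ := (2 : ℝ) ^ ((Module.finrank ℝ (EuclideanSpace ℝ d) : ℝ) / 2) with hc
  set cH : ℝ := 1 + 2 * (2 : ℝ) ^ ((Module.finrank ℝ (EuclideanSpace ℝ d) : ℝ) / 2) with hcH
  have hc0 : 0 < c := Real.rpow_pos_of_pos two_pos _
  have hcH0 : 0 < cH := by rw [hcH]; positivity
  have h1β : 0 < 1 - β := by linarith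
  -- far field: sup `P0 B`, Lipschitz `P1 B`; near field: size `K2 A σ^{β/2-1}`, gradient `K3 A σ^{(β-3)/2}`
  set P0 : ℝ := 2 * c ^ 2 with hP0
  set P1 : ℝ := (3 : ℝ) ^ ((3 : ℝ) / 2) * c ^ 3 with hP1
  set K2 : ℝ := 2 * c ^ 2 * cH with hK2
  set K3 : ℝ := (3 : ℝ) ^ ((3 : ℝ) / 2) * c ^ 3 * cH * ((2 : ℝ) ^ (β / 2) / (3 : ℝ) ^ (β / 2)) with hK3
  have hP00 : 0 ≤ P0 := by positivity
  have hP10 : 0 ≤ P1 := by positivity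
  have hK20 : 0 ≤ K2 := by positivity
  have hK30 : 0 ≤ K3 := by positivity
  -- the Hölder constant of the near field and the total constant
  set KN : ℝ := 4 * K2 / β + 2 * K3 / (1 - β) with hKN
  have hKN0 : 0 ≤ KN := by positivity
  set K : ℝ := (P1 + 2 * P0) + (2 * K2 / β + KN) with hK
  have hK0 : 0 ≤ K := by positivity
  refine ⟨K, hK0, ?_⟩
  intro u f hu hf v₁ v₂ hΔ B hB A hA hH
  -- notation
  set g : UnitAddTorus d → F := fun z => FunctionSpaces.Torus.lineDeriv
    (fun z' => FunctionSpaces.Torus.lineDeriv u z' v₂) z v₁ with hg_def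
  set f₂ : UnitAddTorus d → F := fun z => FunctionSpaces.Torus.lineDeriv
    (fun z' => FunctionSpaces.Torus.lineDeriv f z' v₂) z v₁ with hf₂_def
  have hg : FunctionSpaces.Torus.IsSmooth g := (hu.lineDeriv v₂).lineDeriv v₁
  have hf₂ : FunctionSpaces.Torus.IsSmooth f₂ := (hf.lineDeriv v₂).lineDeriv v₁
  have hB0 : 0 ≤ B := (norm_nonneg _).trans (hB 0)
  set n12 : ℝ := ‖v₁‖ * ‖v₂‖ with hn12
  have hn0 : 0 ≤ n12 := by positivity
  -- the near-field family and its bounds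
  set Φ : ℝ → EuclideanSpace ℝ d → F := fun σ x => heatExtension (FunctionSpaces.Torus.lift f₂) σ x
    with hΦ_def
  have hΦc : ∀ x, ContinuousOn (fun σ => Φ σ x) (Ioi 0) := fun x =>
    continuousOn_heatExtension_time (memLp_top_lift hf₂.continuous) le_top x
  have hΦb : ∀ σ ∈ Ioc (0 : ℝ) 1, ∀ x, ‖Φ σ x‖ ≤ K2 * A * n12 * σ ^ (β / 2 - 1) := by
    intro σ hσ x
    have h := norm_heatExtension_lift_lineDeriv₂_le_rpow hf hA hβ0.le hβ1.le hH hσ.1 x v₁ v₂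
    rw [← hc, ← hcH] at h
    refine h.trans_eq ?_
    rw [hK2, hn12]; ring
  have hΦl : ∀ σ ∈ Ioc (0 : ℝ) 1, ∀ x y, ‖Φ σ x - Φ σ y‖ ≤ K3 * A * n12 * σ ^ ((β - 3) / 2) * ‖x - y‖ := by
    intro σ hσ x y
    have h := norm_heatExtension_lift_lineDeriv₂_sub_le_rpow hf hA hβ0.le hβ1.le hH hσ.1 v₁ v₂ x y
    rw [← hc, ← hcH] at h
    refine h.trans_eq ?_
    rw [hK3, hn12]; ring
  have hKA : 0 ≤ K2 * A * n12 := by positivity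
  have hLA : 0 ≤ K3 * A * n12 := by positivity
  -- near field: integrability, size and Hölder bound
  have hN : ∀ x, IntegrableOn (fun σ => Φ σ x) (Ioc 0 1) ∧
      ‖∫ σ in Ioc 0 1, Φ σ x‖ ≤ K2 * A * n12 / (β / 2) := fun x =>
    norm_integral_Ioc_le_of_norm_le_rpow (hΦc x) (by positivity) (fun σ hσ => hΦb σ hσ x)
  have hNH := norm_integral_Ioc_sub_le_of_bounds hβ0 hβ1 hKA hLA hΦc hΦb hΦl
  -- the representation
  have hrep : ∀ x, FunctionSpaces.Torus.lift g x =
      heatExtension (FunctionSpaces.Torus.lift g) 1 x - ∫ σ in Ioc 0 1, Φ σ x := fun x =>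
    lift_eq_heatExtension_one_sub_integral hg (fun z => hΔ z) x (hN x).1
  -- far field bounds
  have hF0 : ∀ x, ‖heatExtension (FunctionSpaces.Torus.lift g) 1 x‖ ≤ P0 * B * n12 := by
    intro x
    have h := norm_heatExtension_one_lift_lineDeriv₂_le hu hB x v₁ v₂
    rw [← hc] at h
    refine h.trans_eq ?_
    rw [hP0, hn12]; ring
  have hF1 : ∀ x y, ‖heatExtension (FunctionSpaces.Torus.lift g) 1 x -
      heatExtension (FunctionSpaces.Torus.lift g) 1 y‖ ≤ P1 * B * n12 * ‖x - y‖ := by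
    intro x y
    have h := norm_heatExtension_one_lift_lineDeriv₂_sub_le hu hB v₁ v₂ x y
    rw [← hc] at h
    refine h.trans_eq ?_
    rw [hP1, hn12]; ring
  have hK2β : 0 ≤ 2 * K2 / β := by positivity
  have hKP0 : P0 ≤ K := by rw [hK]; linarith
  have hKfar : P1 + 2 * P0 ≤ K := by rw [hK]; linarith
  have hKK2 : 2 * K2 / β ≤ K := by rw [hK]; linarith
  have hKKN : KN ≤ K := by rw [hK]; linarith
  refine ⟨fun x => ?_, fun x y => ?_⟩
  · -- sup bound
    rw [hrep x]
    have hcoef : P0 * B + 2 * K2 / β * A ≤ K * (B + A) := by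
      have h1 : P0 * B ≤ K * B := mul_le_mul_of_nonneg_right hKP0 hB0
      have h2 : 2 * K2 / β * A ≤ K * A := mul_le_mul_of_nonneg_right hKK2 hA
      linarith
    calc ‖heatExtension (FunctionSpaces.Torus.lift g) 1 x - ∫ σ in Ioc 0 1, Φ σ x‖
        ≤ ‖heatExtension (FunctionSpaces.Torus.lift g) 1 x‖ + ‖∫ σ in Ioc 0 1, Φ σ x‖ := norm_sub_le _ _
      _ ≤ P0 * B * n12 + K2 * A * n12 / (β / 2) := add_le_add (hF0 x) (hN x).2
      _ = (P0 * B + 2 * K2 / β * A) * n12 := by rw [div_div_eq_mul_div]; ring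
      _ ≤ K * (B + A) * n12 := mul_le_mul_of_nonneg_right hcoef hn0
      _ = K * (B + A) * ‖v₁‖ * ‖v₂‖ := by rw [hn12]; ring
  · -- Hölder bound
    set h : ℝ := ‖x - y‖ with hh_def
    have hh0 : 0 ≤ h := norm_nonneg _
    -- far field is `β`-Hölder with constant `(P1 + 2 P0) B n12`
    have hfar : ‖heatExtension (FunctionSpaces.Torus.lift g) 1 x -
        heatExtension (FunctionSpaces.Torus.lift g) 1 y‖ ≤ (P1 + 2 * P0) * B * n12 * h ^ β := by
      rcases le_or_gt h 1 with hle | hgt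
      · have hhβ : h ≤ h ^ β := by
          rcases hh0.eq_or_lt with h0 | hpos
          · rw [← h0, Real.zero_rpow hβ0.ne']
          · exact Real.self_le_rpow_of_le_one hh0 hle hβ1.le
        calc ‖heatExtension (FunctionSpaces.Torus.lift g) 1 x - heatExtension (FunctionSpaces.Torus.lift g) 1 y‖
            ≤ P1 * B * n12 * h := hF1 x y
          _ ≤ P1 * B * n12 * h ^ β := mul_le_mul_of_nonneg_left hhβ (by positivity)
          _ ≤ (P1 + 2 * P0) * B * n12 * h ^ β := by
              have : P1 ≤ P1 + 2 * P0 := by linarith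
              have hhb : 0 ≤ h ^ β := Real.rpow_nonneg hh0 β
              gcongr
      · have h1h : 1 ≤ h ^ β := Real.one_le_rpow hgt.le hβ0.le
        calc ‖heatExtension (FunctionSpaces.Torus.lift g) 1 x - heatExtension (FunctionSpaces.Torus.lift g) 1 y‖
            ≤ ‖heatExtension (FunctionSpaces.Torus.lift g) 1 x‖ +
                ‖heatExtension (FunctionSpaces.Torus.lift g) 1 y‖ := norm_sub_le _ _
          _ ≤ P0 * B * n12 + P0 * B * n12 := add_le_add (hF0 x) (hF0 y)
          _ = (2 * P0) * B * n12 * 1 := by ring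
          _ ≤ (P1 + 2 * P0) * B * n12 * h ^ β := by
              have : 2 * P0 ≤ P1 + 2 * P0 := by linarith
              gcongr
    have hnear := hNH x y
    rw [hrep x, hrep y]
    calc ‖heatExtension (FunctionSpaces.Torus.lift g) 1 x - (∫ σ in Ioc 0 1, Φ σ x) -
          (heatExtension (FunctionSpaces.Torus.lift g) 1 y - ∫ σ in Ioc 0 1, Φ σ y)‖
        = ‖(heatExtension (FunctionSpaces.Torus.lift g) 1 x - heatExtension (FunctionSpaces.Torus.lift g) 1 y) -
            ((∫ σ in Ioc 0 1, Φ σ x) - ∫ σ in Ioc 0 1, Φ σ y)‖ := by abel_nf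
      _ ≤ ‖heatExtension (FunctionSpaces.Torus.lift g) 1 x - heatExtension (FunctionSpaces.Torus.lift g) 1 y‖ +
            ‖(∫ σ in Ioc 0 1, Φ σ x) - ∫ σ in Ioc 0 1, Φ σ y‖ := norm_sub_le _ _
      _ ≤ (P1 + 2 * P0) * B * n12 * h ^ β +
            (4 * (K2 * A * n12) / β + 2 * (K3 * A * n12) / (1 - β)) * h ^ β := add_le_add hfar hnear
      _ = ((P1 + 2 * P0) * B + KN * A) * n12 * h ^ β := by rw [hKN]; ring
      _ ≤ K * (B + A) * n12 * h ^ β := by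
          have hhb : 0 ≤ h ^ β := Real.rpow_nonneg hh0 β
          have hcoef : (P1 + 2 * P0) * B + KN * A ≤ K * (B + A) := by
            have h1 : (P1 + 2 * P0) * B ≤ K * B := mul_le_mul_of_nonneg_right hKfar hB0
            have h2 : KN * A ≤ K * A := mul_le_mul_of_nonneg_right hKKN hA
            linarith
          exact mul_le_mul_of_nonneg_right (mul_le_mul_of_nonneg_right hcoef hn0) hhb
      _ = K * (B + A) * ‖v₁‖ * ‖v₂‖ * ‖x - y‖ ^ β := by rw [hn12, hh_def]; ring

end HolderEstimate

end TorusHeat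

end Literature.Analysis.FluidPDE
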